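import Summits.HodgeConjecture.CorCM.StabiliserOrbitSelfConjugate
import Summits.HodgeConjecture.CorCM.GenericCMFieldSameFieldFamiliesHodge
import Summits.HodgeConjecture.CorCM.PointwiseConjugationCompositum
import HarnessLib

/-!
# CM fields with self-conjugate stabiliser orbits: every CM type is nondegenerate and simple, families of types of the
# field are decided by their type vectors, and the field test `x₀(K) ⊄ x(K) · x₀(K⁺)`

COR-CM (cell `pub-hodgecm2`, binder seat `b16` gen 54, count-neutral claim STAB-CONJ, file F2 — the CM-field dress of F1
`CorCM/StabiliserOrbitSelfConjugate`; theorems only, no definition, no named fact, no `sorry`).  NEW as stated, hence under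
`Summits/`.  HONEST FRAMING: statements about CM types of ONE CM field and about products of CM abelian varieties with
complex multiplication by that field; `HC_CM` is neither used nor asserted — these are «HC for NAMED classes» results.

THE HYPOTHESIS (SC) for a CM field `K` (`ρ` = complex conjugation acting on `Hom(K, ℂ)` by `s ↦ s̄`):

  `∀ x₀ x : K → ℂ, x ∉ {x₀, x̄₀} → ∃ σ ∈ Aut(ℂ), σ ∘ x₀ = x₀ ∧ σ ∘ x = x̄`

— one automorphism per pair `(x₀, x)`, fixing `x₀` and conjugating `x`, arbitrary on the other embeddings.  By F1 this is
EQUIVALENT to multiplicity one of the odd weights (the tree's (M1)); pair flips (`[Kᶜ:ℚ] = 2ⁿ·[K⁺ᶜ:ℚ]`, p2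
`GenericCMFieldTypes`) and double flips (even sign kernel, degree `≥ 6`, this seat gen 46) are instances (§4).

* §1 `stabConj_of_stabConj_at` (ONE base point suffices), **`stabConj_at_iff_not_le`** / **`stabConj_iff_forall_not_le`**
  — THE FIELD TEST: (SC) at `(x₀, x)` iff `x₀(K) ⊄ x(K) · x₀(K⁺)` (gen 48's compositum criterion
  `exists_conj_smul_iff_not_le` read on one field: `x₀(√−δ)` is not in the compositum of the conjugate field `x(K)` with
  the real field `x₀(K⁺)`, i.e. `[x(K)·x₀(K) : x(K)·x₀(K⁺)] = 2`).
* §2 `exists_smul_sub_of_stabConj` ((M1) for `K`), **`isNondegenerate_of_stabConj`** — EVERY CM type of an (SC) field is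
  nondegenerate (`dim MT(A) = dim A + 1`; `B• = D•` on all powers of `A`, the Hodge conjecture for everything isogenous
  to a power), `isPrimitive_of_stabConj`, **`isSimple_of_stabConj`** (every abelian variety with CM by `K` is simple).
* §3 families of types of ONE (SC) field: **`isNondegenerateFamily_iff_linearIndependent_of_stabConj`** (`Hg(∏ A_i) =
  ∏ Hg(A_i)` iff the type vectors `u_{Φ_i} = 𝟙_{Φ_i} − 𝟙_{Φ̄_i}` are linearly independent),
  **`isNondegenerateFamily_of_card_le_three_of_stabConj`** (up to THREE pairwise non-isogenous varieties with CM by `K` —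
  e.g. `A`, a Galois conjugate `A^σ ≁ A`, and a third one — are always additive: three pairwise non-proportional
  `±1`-vectors are independent), the Hodge conjecture with `B• = D•` on all their products
  (`hodgeConjectureFor_prod_of_card_le_three_of_stabConj`, `hodgeClassSpan_prod_eq_of_card_le_three_of_stabConj`), and
  `exists_exceptional_prod_of_lt_card_of_stabConj` (more than `[K:ℚ]/2` pairwise non-isogenous ones carry an exceptional
  Hodge class on some product).
* §4 `stabConj_of_pairFlip`, `stabConj_of_doubleFlip` (CM forms).

## References

* [Shimura1998] G. Shimura, *Abelian Varieties with Complex Multiplication and Modular Functions*, §8.2 Prop. 26, §18.2.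
* [Kubota1965] T. Kubota, *On the field extension by complex multiplication*, Trans. AMS 118 (1965), §2 Lemma 2.
* [Mai1989] L. Mai, *Lower bounds for the ranks of CM types*, J. Number Theory 32 (1989), §2 Prop. 1 (proof).
* [Gordon1999HodgeAVSurvey] B. B. Gordon, *A survey of the Hodge conjecture for abelian varieties*, §3, 7.5–7.7, 10.10.
* [Lang2002] S. Lang, *Algebra*, 3rd ed., V §2 Thm. 2.8, VI §1 Thm. 1.12.
* [Wielandt1964] H. Wielandt, *Finite Permutation Groups* (1964), Thm. 28.4.
-/

set_option autoImplicit false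

noncomputable section

open CategoryTheory CategoryTheory.Limits NumberField

namespace Summit.HodgeConjecture.CorCM

open Literature.NumberTheory.ComplexMultiplication
open Literature.AlgebraicGeometry.Motives (AbelianVariety CMType)
open Literature.AlgebraicGeometry.HodgeTheory
open Literature.AlgebraicGeometry.ComplexMultiplication (IsCMTypeRealisation isSimple_iff_isPrimitive)
open Literature.AlgebraicGeometry.VanGeemen1994 (hodgeClassSpan)
open Literature.AlgebraicGeometry.Pohlmann1968
open Literature.Barriers.HodgeConjecture (divisorClassesSpan)
open GenericCMField

variable {K : Type} [Field K] [NumberField K] [IsCMField K]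

/-! ## §1 The hypothesis (SC): one base point suffices; the field test -/

section Hypothesis

/-- No embedding of a CM field is real: `s̄ ≠ s`. [cite: Shimura1998, §18.2 Lemma (i)] -/
theorem conj_smul_ne (s : K →+* ℂ) : (starRingAut : ℂ ≃+* ℂ) • s ≠ s := fun h => by
  rw [conj_smul_eq_conjugate] at h
  exact IsTotallyComplex.complexEmbedding_not_isReal s (ComplexEmbedding.isReal_iff.2 h)

/-- **(SC) at ONE base embedding `x₀` gives (SC) at every base embedding** (`Aut(ℂ)` is transitive on `Hom(K, ℂ)` and
commutes with complex conjugation there). [cite: Wielandt1964, Thm. 28.4] -/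
theorem stabConj_of_stabConj_at {x₀ : K →+* ℂ}
    (hSC₀ : ∀ x : K →+* ℂ, x ≠ x₀ → x ≠ (starRingAut : ℂ ≃+* ℂ) • x₀ →
      ∃ σ : ℂ ≃+* ℂ, σ • x₀ = x₀ ∧ σ • x = (starRingAut : ℂ ≃+* ℂ) • x)
    (x₁ x : K →+* ℂ) (hx : x ≠ x₁) (hx' : x ≠ (starRingAut : ℂ ≃+* ℂ) • x₁) :
    ∃ σ : ℂ ≃+* ℂ, σ • x₁ = x₁ ∧ σ • x = (starRingAut : ℂ ≃+* ℂ) • x := by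
  haveI := isPretransitive_ringEquiv_complex (K := K)
  exact StabConj.stabConj_of_stabConj_at (G := ℂ ≃+* ℂ) (ρ := (starRingAut : ℂ ≃+* ℂ)) smul_conj_smul hSC₀ x₁ x
    hx hx'

/-- **THE FIELD TEST for (SC) at `(x₀, x)`**: some `σ ∈ Aut(ℂ)` fixes `x₀` and conjugates `x` iff
`x₀(K) ⊄ x(K) · x₀(K⁺)` (the compositum of the conjugate field `x(K)` with the real field `x₀(K⁺)` does not contain
`x₀(K)`; equivalently `[x(K)·x₀(K) : x(K)·x₀(K⁺)] = 2`). [cite: Lang2002, V §2 Thm. 2.8 and VI §1 Thm. 1.12] -/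
theorem stabConj_at_iff_not_le (x₀ x : K →+* ℂ) :
    (∃ σ : ℂ ≃+* ℂ, σ • x₀ = x₀ ∧ σ • x = (starRingAut : ℂ ≃+* ℂ) • x) ↔
      ¬ x₀.toRatAlgHom.fieldRange ≤
        x.toRatAlgHom.fieldRange ⊔ (x₀.comp (maximalRealSubfield K).subtype).toRatAlgHom.fieldRange := by
  rw [← exists_conj_smul_iff_not_le (K := fun _ : Unit => K) (a := ()) (b := ()) x x₀]
  exact ⟨fun ⟨σ, h₀, hx⟩ => ⟨σ, hx, h₀⟩, fun ⟨σ, hx, h₀⟩ => ⟨σ, h₀, hx⟩⟩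

/-- **(SC) for `K` in field form**: for ONE embedding `x₀` and every `x ∉ {x₀, x̄₀}`, `x₀(K) ⊄ x(K) · x₀(K⁺)`.
[cite: Lang2002, V §2 Thm. 2.8 and VI §1 Thm. 1.12] -/
theorem stabConj_iff_forall_not_le (x₀ : K →+* ℂ) :
    (∀ x₁ x : K →+* ℂ, x ≠ x₁ → x ≠ (starRingAut : ℂ ≃+* ℂ) • x₁ →
      ∃ σ : ℂ ≃+* ℂ, σ • x₁ = x₁ ∧ σ • x = (starRingAut : ℂ ≃+* ℂ) • x) ↔
    ∀ x : K →+* ℂ, x ≠ x₀ → x ≠ (starRingAut : ℂ ≃+* ℂ) • x₀ →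
      ¬ x₀.toRatAlgHom.fieldRange ≤
        x.toRatAlgHom.fieldRange ⊔ (x₀.comp (maximalRealSubfield K).subtype).toRatAlgHom.fieldRange :=
  ⟨fun h x hx hx' => (stabConj_at_iff_not_le x₀ x).1 (h x₀ x hx hx'),
    fun h => stabConj_of_stabConj_at fun x hx hx' => (stabConj_at_iff_not_le x₀ x).2 (h x hx hx')⟩

end Hypothesis

/-! ## §2 Every CM type of an (SC) field is nondegenerate -/

section Types

/-- **(SC) ⟹ (M1) for a CM field**: every `Aut(ℂ)`-equivariant linear map `ℚ^{Hom(K,ℂ)} → ℚ^{Hom(K,ℂ)}` with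
conjugation-odd values is a scalar multiple of `f ↦ f − f∘ρ`. [cite: Wielandt1964, Thm. 28.4] [cite: Kubota1965, §2 Lemma 2] -/
theorem exists_smul_sub_of_stabConj
    (hSC : ∀ x₀ x : K →+* ℂ, x ≠ x₀ → x ≠ (starRingAut : ℂ ≃+* ℂ) • x₀ →
      ∃ σ : ℂ ≃+* ℂ, σ • x₀ = x₀ ∧ σ • x = (starRingAut : ℂ ≃+* ℂ) • x)
    (T : ((K →+* ℂ) → ℚ) →ₗ[ℚ] ((K →+* ℂ) → ℚ))
    (hT : ∀ (g : ℂ ≃+* ℂ) (f : (K →+* ℂ) → ℚ), T (fun x => f (g⁻¹ • x)) = fun x => T f (g⁻¹ • x))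
    (hodd : ∀ (f : (K →+* ℂ) → ℚ) (x : K →+* ℂ), T f ((starRingAut : ℂ ≃+* ℂ) • x) = -T f x) :
    ∃ c : ℚ, ∀ f, T f = c • fun x => f x - f ((starRingAut : ℂ ≃+* ℂ) • x) := by
  classical
  haveI := isPretransitive_ringEquiv_complex (K := K)
  exact StabConj.exists_smul_sub_of_stabConj (G := ℂ ≃+* ℂ) conj_smul_conj_smul conj_smul_ne hSC T hT hodd

/-- **Every CM type of an (SC) field is nondegenerate**: `rank(Φ) = [K:ℚ]/2 + 1` (`dim MT(A_Φ) = dim A_Φ + 1`; `B• = D•`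
on all powers of `A_Φ`). [cite: Kubota1965, §2 Lemma 2] [cite: Mai1989, §2 Prop. 1 (proof)] -/
theorem isNondegenerate_of_stabConj
    (hSC : ∀ x₀ x : K →+* ℂ, x ≠ x₀ → x ≠ (starRingAut : ℂ ≃+* ℂ) • x₀ →
      ∃ σ : ℂ ≃+* ℂ, σ • x₀ = x₀ ∧ σ • x = (starRingAut : ℂ ≃+* ℂ) • x)
    (Φ : CMType K) : IsNondegenerate Φ := by
  classical
  rw [isNondegenerate_iff, cmTypeRank, ← Embeddings.card K ℂ]
  exact typeRank_eq_of_multiplicityOne (isCMTypeWith_conj Φ) (exists_smul_sub_of_stabConj hSC)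

/-- **Every CM type of an (SC) field is primitive** (nondegenerate ⟹ primitive). [cite: Shimura1998, §8.2 Prop. 26] -/
theorem isPrimitive_of_stabConj
    (hSC : ∀ x₀ x : K →+* ℂ, x ≠ x₀ → x ≠ (starRingAut : ℂ ≃+* ℂ) • x₀ →
      ∃ σ : ℂ ≃+* ℂ, σ • x₀ = x₀ ∧ σ • x = (starRingAut : ℂ ≃+* ℂ) • x)
    (Φ : CMType K) (s₀ : K →+* ℂ) : IsPrimitive (ℂ ≃+* ℂ) Φ.1 s₀ :=
  (isNondegenerate_of_stabConj hSC Φ).isPrimitive s₀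

/-- **Every abelian variety with complex multiplication by an (SC) field is simple.** [cite: Shimura1998, §8.2 Prop. 26] -/
theorem isSimple_of_stabConj
    (hSC : ∀ x₀ x : K →+* ℂ, x ≠ x₀ → x ≠ (starRingAut : ℂ ≃+* ℂ) • x₀ →
      ∃ σ : ℂ ≃+* ℂ, σ • x₀ = x₀ ∧ σ • x = (starRingAut : ℂ ≃+* ℂ) • x)
    {Φ : CMType K} {A : AbelianVariety ℂ} {ι : 𝓞 K →+* End A} {θ : K →+* Module.End ℂ (complexBetti A.X 1)}
    (hA : IsCMTypeRealisation Φ A ι θ) : A.IsSimple := by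
  obtain ⟨s₀⟩ : Nonempty (K →+* ℂ) := inferInstance
  exact (isSimple_iff_isPrimitive hA s₀).2 (isPrimitive_of_stabConj hSC Φ s₀)

end Types

/-! ## §3 Families of types of one (SC) field -/

section Families

variable {I : Type} [Fintype I] [Nonempty I] {Φ : I → CMType K} {A : I → AbelianVariety ℂ}
  {ι : ∀ i, 𝓞 K →+* End (A i)} {θ : ∀ i, K →+* Module.End ℂ (complexBetti (A i).X 1)}

/-- **For an (SC) field, a family of CM types is nondegenerate ⟺ its type vectors are linearly independent**
(`Hg(∏ A_{Φ_i}) = ∏ Hg(A_{Φ_i})` iff the `u_{Φ_i} = 𝟙_{Φ_i} − 𝟙_{Φ̄_i} ∈ ℚ^{Hom(K,ℂ)}` are independent).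
[cite: Mai1989, §2 Prop. 1 (proof)] [cite: Gordon1999HodgeAVSurvey, 7.5–7.7] -/
theorem isNondegenerateFamily_iff_linearIndependent_of_stabConj
    (hSC : ∀ x₀ x : K →+* ℂ, x ≠ x₀ → x ≠ (starRingAut : ℂ ≃+* ℂ) • x₀ →
      ∃ σ : ℂ ≃+* ℂ, σ • x₀ = x₀ ∧ σ • x = (starRingAut : ℂ ≃+* ℂ) • x)
    (Φ : I → CMType K) :
    CMAlgebra.IsNondegenerateFamily (K := fun _ : I => K) Φ ↔
      LinearIndependent ℚ fun i => antiVec (Φ i).1 (1 : ℂ ≃+* ℂ) := by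
  classical
  rw [isNondegenerateFamily_iff_typeRank_sigmaType_eq]
  exact typeRank_sigmaType_eq_iff_linearIndependent_of_multiplicityOne (fun i => (Φ i).1)
    (fun i => isCMTypeWith_conj (Φ i)) (exists_smul_sub_of_stabConj hSC)

/-- **(SC) field, at most three pairwise non-isogenous abelian varieties with CM by `K` (e.g. `A`, a Galois conjugate
`A^σ ≁ A` and a third): the family of their types is nondegenerate** — three pairwise non-proportional `±1`-vectors are
linearly independent. [cite: Gordon1999HodgeAVSurvey, 7.5–7.7] -/
theorem isNondegenerateFamily_of_card_le_three_of_stabConj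
    (hSC : ∀ x₀ x : K →+* ℂ, x ≠ x₀ → x ≠ (starRingAut : ℂ ≃+* ℂ) • x₀ →
      ∃ σ : ℂ ≃+* ℂ, σ • x₀ = x₀ ∧ σ • x = (starRingAut : ℂ ≃+* ℂ) • x)
    (hA : ∀ i, IsCMTypeRealisation (Φ i) (A i) (ι i) (θ i))
    (hniso : ∀ i j, i ≠ j → ¬AbelianVariety.IsIsogenous (A i) (A j)) (hcard : Fintype.card I ≤ 3) :
    CMAlgebra.IsNondegenerateFamily (K := fun _ : I => K) Φ := by
  classical
  rw [isNondegenerateFamily_iff_linearIndependent_of_stabConj hSC]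
  exact linearIndependent_of_sign_of_card_le_three (fun i => antiVec (Φ i).1 (1 : ℂ ≃+* ℂ))
    (fun i s => antiVec_one_apply_eq_or (Φ i) s)
    (fun i j hij => antiVec_ne_of_not_isIsogenous (hA i) (hA j) (hniso i j hij)) hcard

/-- **The Hodge conjecture on every product `⨁_{j<N} A_{π j}` of at most three pairwise non-isogenous abelian varieties
with complex multiplication by one (SC) field**, UNCONDITIONALLY. [cite: Gordon1999HodgeAVSurvey, 7.5 and 10.10] -/
theorem hodgeConjectureFor_prod_of_card_le_three_of_stabConj
    (hSC : ∀ x₀ x : K →+* ℂ, x ≠ x₀ → x ≠ (starRingAut : ℂ ≃+* ℂ) • x₀ →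
      ∃ σ : ℂ ≃+* ℂ, σ • x₀ = x₀ ∧ σ • x = (starRingAut : ℂ ≃+* ℂ) • x)
    (hA : ∀ i, IsCMTypeRealisation (Φ i) (A i) (ι i) (θ i))
    (hniso : ∀ i j, i ≠ j → ¬AbelianVariety.IsIsogenous (A i) (A j)) (hcard : Fintype.card I ≤ 3)
    {N : ℕ} (π : Fin N → I) :
    HodgeConjectureFor (⨁ fun j : Fin N => A (π j)).dim (⨁ fun j : Fin N => A (π j)).X :=
  (isNondegenerateFamily_of_card_le_three_of_stabConj hSC hA hniso hcard).hodgeConjectureFor_prod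
    (K := fun _ : I => K) hA π

/-- … and every Hodge class on these products is a polynomial in divisor classes (`Bᵐ ⊗ ℂ = Dᵐ ⊗ ℂ`).
[cite: Gordon1999HodgeAVSurvey, 7.5 and 10.10] -/
theorem hodgeClassSpan_prod_eq_of_card_le_three_of_stabConj
    (hSC : ∀ x₀ x : K →+* ℂ, x ≠ x₀ → x ≠ (starRingAut : ℂ ≃+* ℂ) • x₀ →
      ∃ σ : ℂ ≃+* ℂ, σ • x₀ = x₀ ∧ σ • x = (starRingAut : ℂ ≃+* ℂ) • x)
    (hA : ∀ i, IsCMTypeRealisation (Φ i) (A i) (ι i) (θ i))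
    (hniso : ∀ i j, i ≠ j → ¬AbelianVariety.IsIsogenous (A i) (A j)) (hcard : Fintype.card I ≤ 3)
    {N : ℕ} (π : Fin N → I) (m : ℕ) :
    hodgeClassSpan (⨁ fun j : Fin N => A (π j)).dim (⨁ fun j : Fin N => A (π j)).X m =
      divisorClassesSpan (⨁ fun j : Fin N => A (π j)).X (⨁ fun j : Fin N => A (π j)).dim m :=
  (isNondegenerateFamily_of_card_le_three_of_stabConj hSC hA hniso hcard).hodgeClassSpan_prod_eq_divisorClassesSpan
    (K := fun _ : I => K) hA π m

/-- **More than `[K:ℚ]/2` pairwise non-isogenous abelian varieties with CM by one (SC) field carry an exceptional Hodge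
class on some product `⨁_{j<N} A_{π j}`** (the family is separating — every member is simple — but has more members than
the odd weights have dimensions). [cite: Gordon1999HodgeAVSurvey, 7.6.1 and 7.7] -/
theorem exists_exceptional_prod_of_lt_card_of_stabConj
    (hSC : ∀ x₀ x : K →+* ℂ, x ≠ x₀ → x ≠ (starRingAut : ℂ ≃+* ℂ) • x₀ →
      ∃ σ : ℂ ≃+* ℂ, σ • x₀ = x₀ ∧ σ • x = (starRingAut : ℂ ≃+* ℂ) • x)
    (hA : ∀ i, IsCMTypeRealisation (Φ i) (A i) (ι i) (θ i))
    (hniso : ∀ i j, i ≠ j → ¬AbelianVariety.IsIsogenous (A i) (A j))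
    (hcard : Module.finrank ℚ K / 2 < Fintype.card I) :
    ∃ (N : ℕ) (π : Fin N → I) (m : ℕ) (c : complexBetti (⨁ fun j : Fin N => A (π j)).X (2 * m)),
      IsRationalClass c ∧
      IsOfHodgeType (⨁ fun j : Fin N => A (π j)).dim (⨁ fun j : Fin N => A (π j)).X (2 * m) m m c ∧
      c ∉ divisorClassesSpan (⨁ fun j : Fin N => A (π j)).X (⨁ fun j : Fin N => A (π j)).dim m :=
  CMAlgebra.exists_exceptional_prod_of_not_isNondegenerateFamily (K := fun _ : I => K)
    (CMAlgebra.isSeparatingFamily_of_isSimple_of_pairwise_not_isIsogenous hA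
      (fun i => isSimple_of_stabConj hSC (hA i)) hniso)
    (fun hΦ => absurd (card_le_finrank_div_two_of_isNondegenerateFamily Φ hΦ) (not_le.2 hcard)) hA

end Families

/-! ## §4 Pair flips and double flips are instances -/

section Instances

omit [NumberField K] [IsCMField K] in
/-- **A pair-flip CM field satisfies (SC).** [cite: Dodson1984, §1.1] -/
theorem stabConj_of_pairFlip
    (hflip : ∀ s : K →+* ℂ, ∃ σ : ℂ ≃+* ℂ, σ • s = (starRingAut : ℂ ≃+* ℂ) • s ∧
      ∀ t : K →+* ℂ, t ≠ s → t ≠ (starRingAut : ℂ ≃+* ℂ) • s → σ • t = t)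
    (x₀ x : K →+* ℂ) (hx : x ≠ x₀) (hx' : x ≠ (starRingAut : ℂ ≃+* ℂ) • x₀) :
    ∃ σ : ℂ ≃+* ℂ, σ • x₀ = x₀ ∧ σ • x = (starRingAut : ℂ ≃+* ℂ) • x :=
  StabConj.stabConj_of_pairFlip (G := ℂ ≃+* ℂ) conj_smul_conj_smul hflip x₀ x hx hx'

omit [IsCMField K] in
/-- **A double-flip CM field of degree `≥ 6` satisfies (SC).** [cite: Dodson1984, §1.1 and §5.1] -/
theorem stabConj_of_doubleFlip (h6 : 6 ≤ Module.finrank ℚ K)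
    (hflip : ∀ s t : K →+* ℂ, t ≠ s → t ≠ (starRingAut : ℂ ≃+* ℂ) • s → ∃ σ : ℂ ≃+* ℂ,
      σ • s = (starRingAut : ℂ ≃+* ℂ) • s ∧ σ • t = (starRingAut : ℂ ≃+* ℂ) • t ∧
      ∀ y : K →+* ℂ, y ≠ s → y ≠ (starRingAut : ℂ ≃+* ℂ) • s → y ≠ t → y ≠ (starRingAut : ℂ ≃+* ℂ) • t →
        σ • y = y)
    (x₀ x : K →+* ℂ) (hx : x ≠ x₀) (hx' : x ≠ (starRingAut : ℂ ≃+* ℂ) • x₀) :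
    ∃ σ : ℂ ≃+* ℂ, σ • x₀ = x₀ ∧ σ • x = (starRingAut : ℂ ≃+* ℂ) • x := by
  classical
  refine StabConj.stabConj_of_doubleFlip (G := ℂ ≃+* ℂ) conj_smul_conj_smul ?_ hflip x₀ x hx hx'
  rwa [Embeddings.card K ℂ]

end Instances

end Summit.HodgeConjecture.CorCM

end
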